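import Literature.NumberTheory.EllipticCurves.IsogenyBaseChange
import Literature.NumberTheory.EllipticCurves.PotentialGoodReductionInertiaProofs
import HarnessLib

/-!
# Isogenies and algebraic maps of geometric points under extension of the ground field

Topic `NumberTheory/EllipticCurves`; `Proofs` file (theorems only, no definitions, no named facts).
The tree records an isogeny `φ : E → E'` of Weierstrass curves over a field `k` through its action on
the geometric points `E(k̄) → E'(k̄)` (`WeierstrassCurve.Isogeny`: additive, agreeing with an affine
rational map `(P₁/Q₁, P₂/Q₂)` with `k̄`-coefficients off a finite set — `WeierstrassCurve.IsAlgebraicOn` —,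
`Γ_k`-equivariant, with finite kernel). For an ALGEBRAIC extension `K/k` the geometric points of the
base change `E_K` are "the same" group: the tree's explicit identification
`e_E : E(k̄) ≃ E_K(K̄)`, `P ↦ ι_* P` along the chosen `k`-embedding `ι : k̄ → K̄`
(`Literature.NumberTheory.GaloisRepresentations.absClosureEmbedding`, bijective for `K/k` algebraic:
`Literature.NumberTheory.EllipticCurves.pointsMapOfEmb`, `pointsMapOfEmb_bijective`) followed by
`E(K̄) = E_K(K̄)` (`Literature.NumberTheory.EllipticCurves.localPointsEquivGeomPoints`), equivariant along
the restriction `Γ_K → Γ_k` (`localPointsEquivGeomPoints_pointsMapOfEmb_smul`).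

This file proves that along `e` **algebraicity is preserved** — the transported map
`e_{E'} ∘ f ∘ e_E⁻¹` agrees with the rational map whose polynomials are the `ι`-images of those of
`f` (`agreesWithRationalMapAt_transport`, `isAlgebraicOn_transport`) — and deduces:

* `WeierstrassCurve.exists_isogeny_baseChange_of_isAlgebraicOn` — **a `k̄`-algebraic homomorphism
  `f : E(k̄) → E'(k̄)` with finite kernel which commutes with (the restrictions of) `Γ_K` is an isogeny
  `E_K → E'_K` DEFINED OVER `K`**: there is `φ : Isogeny (W.baseChange K) (W'.baseChange K)` with
  `φ ∘ e_E = e_{E'} ∘ f`. This is Silverman's "`φ` is defined over `K` iff `φ^σ = φ` for all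
  `σ ∈ G_{K̄/K}`" (*AEC* I.§3, Ex. 1.12(c); II.2.12) for the tree's encoding; the typical use is a
  CM endomorphism of `E/ℚ`, algebraic over `ℚ̄` but rational only over the CM field.
* `WeierstrassCurve.Isogeny.exists_baseChange_groundField` — every `k`-isogeny `E → E'` base-changes
  to a `K`-isogeny `E_K → E'_K` compatible with `e` (Silverman, *AEC*, III.§4: "if `E`, `E'`, `φ` are
  defined over `k` then …", base change of a morphism).
* bookkeeping along `e` used by consumers: uniqueness of the transported isogeny
  (`isogeny_baseChange_unique`), transport of a quadratic relation `f² + m f = c`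
  (`rel_transport_baseChange`) and of a composition identity `g ∘ f = [n]`
  (`comp_eq_smul_transport_baseChange`), finiteness of the kernel (`finite_ker_transport_baseChange`),
  equivariance (`smul_transport_baseChange`).

Written for cell `bsd-print-cf2` (seat ty2): the CM generator `η` of the inert-order splitting
(`Summits/…/CMKolyvaginAtInertTwoInertOrderSplitting*.lean`) becomes a `K`-ISOGENY, so that it has
local points maps (`WeierstrassCurve.Isogeny.hasLocalPointsMaps_holds`) and preserves Selmer groups.

## References

* J. H. Silverman, *The Arithmetic of Elliptic Curves*, 2nd ed., GTM 106 (2009), I.§3 (rational maps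
  defined over `K`; Ex. 1.12(c)), II.2.12, III.§4 (isogenies), VIII.§1. [SilvermanAEC2009]
* J.-P. Serre, *Galois Cohomology* (1997), II.§1.1 (embeddings of algebraic closures and
  restriction of Galois groups). [SerreGaloisCohomology1997]

## Design notes

* No definition is introduced: the equivalence `e_E` is written out as
  `localPointsEquivGeomPoints W K (pointsMapOfEmb W (absClosureEmbedding k K) P)` in every statement
  (it is the equivalence packaged existentially by `WeierstrassCurve.exists_addEquiv_geomPoints_baseChange`).
* §1 works for an arbitrary `k`-embedding `ι : k̄ →ₐ[k] K̄`; from §2 on `ι` is the chosen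
  `absClosureEmbedding k K`, for which the equivariance along `absGaloisRestrict k K` is in the tree.
* `k K : Type u` live in one universe (as in `ShaRestriction`).
-/

noncomputable section

open scoped Classical

universe u

namespace WeierstrassCurve

open Literature.NumberTheory.EllipticCurves Literature.NumberTheory.GaloisRepresentations Field
open _root_.WeierstrassCurve.geomPoints

variable {k : Type u} [Field k] (K : Type u) [Field K] [Algebra k K]
variable (W W' : WeierstrassCurve k)

/-! ## §1 Transport of affine points, polynomial values and rational representations -/

section Emb

variable (ι : AlgebraicClosure k →ₐ[k] AlgebraicClosure K)

omit W W' in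
/-- `ι (g(x, y)) = g^ι(ι x, ι y)` for the coefficientwise image `g^ι = map ι g` of a two-variable
polynomial (Mathlib's `MvPolynomial.map_eval`). Silverman, *AEC*, I.§3 (`φ^σ`).
[cite: SilvermanAEC2009, I.§3 (Remark 3.1(b), `f^σ`)] -/
theorem emb_eval_vec₂ (g : MvPolynomial (Fin 2) (AlgebraicClosure k)) (x y : AlgebraicClosure k) :
    ι (MvPolynomial.eval ![x, y] g) =
      MvPolynomial.eval ![ι x, ι y] (MvPolynomial.map ι.toRingHom g) := by
  have hv : (ι.toRingHom ∘ ![x, y]) = ![ι x, ι y] := by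
    ext i
    fin_cases i <;> rfl
  rw [← hv, ← MvPolynomial.map_eval]
  rfl

/-- **The transport `e_E = (E(K̄) = E_K(K̄)) ∘ ι_*` on an affine point**: `e_E (x, y) = (ι x, ι y)`.
Silverman, *AEC*, VIII.§1 (`E(K̄)` as a `G_{K̄/K}`-module; points over extensions).
[cite: SilvermanAEC2009, VIII.§1] -/
theorem localPointsEquivGeomPoints_pointsMapOfEmb_some {x y : AlgebraicClosure k}
    (h : (W.baseChange (AlgebraicClosure k)).toAffine.Nonsingular x y) :
    ∃ h', localPointsEquivGeomPoints W K (pointsMapOfEmb W ι (.some x y h)) =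
      (.some (ι x) (ι y) h' : geomPoints (W.baseChange K)) := by
  change ∃ h', pointsCongr W K (AlgebraicClosure K) (Affine.Point.map ι (.some x y h)) = _
  rw [Affine.Point.map_some, pointsCongr, Affine.Point.congrEquiv_some]
  exact ⟨_, rfl⟩

/-- The transport `e_E` is injective, so it preserves being non-zero. [cite: SilvermanAEC2009, VIII.§1] -/
theorem localPointsEquivGeomPoints_pointsMapOfEmb_ne_zero {P : geomPoints W} (hP : P ≠ 0) :
    localPointsEquivGeomPoints W K (pointsMapOfEmb W ι P) ≠ 0 := by
  intro h
  rw [map_eq_zero_iff _ (localPointsEquivGeomPoints W K).injective] at h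
  exact hP (pointsMapOfEmb_injective W ι (by rw [h, map_zero]))

/-- **Agreement with a rational map is transported along `e`.** If `f : E(k̄) → E'(k̄)` agrees with
`(P₁/Q₁, P₂/Q₂)` at `P`, and `g : E_K(K̄) → E'_K(K̄)` satisfies `g ∘ e_E = e_{E'} ∘ f`, then `g` agrees
with `(P₁^ι/Q₁^ι, P₂^ι/Q₂^ι)` at `e_E P`. Silverman, *AEC*, I.§3 (`φ(P)^σ = φ^σ(P^σ)`, Remark 3.1(b) and
Ex. 1.12). [cite: SilvermanAEC2009, I.§3 Remark 3.1(b)] -/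
theorem agreesWithRationalMapAt_transport {f : geomPoints W → geomPoints W'}
    {g : geomPoints (W.baseChange K) → geomPoints (W'.baseChange K)}
    (hg : ∀ P : geomPoints W, g (localPointsEquivGeomPoints W K (pointsMapOfEmb W ι P)) =
      localPointsEquivGeomPoints W' K (pointsMapOfEmb W' ι (f P)))
    {P₁ Q₁ P₂ Q₂ : MvPolynomial (Fin 2) (AlgebraicClosure k)} {P : geomPoints W}
    (hP : AgreesWithRationalMapAt W W' P₁ Q₁ P₂ Q₂ f P) :
    AgreesWithRationalMapAt (W.baseChange K) (W'.baseChange K)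
      (MvPolynomial.map ι.toRingHom P₁) (MvPolynomial.map ι.toRingHom Q₁)
      (MvPolynomial.map ι.toRingHom P₂) (MvPolynomial.map ι.toRingHom Q₂) g
      (localPointsEquivGeomPoints W K (pointsMapOfEmb W ι P)) := by
  obtain ⟨x, y, h, rfl, hQ₁, hQ₂, h', hfP⟩ := hP
  obtain ⟨hι, eι⟩ := localPointsEquivGeomPoints_pointsMapOfEmb_some K W ι h
  have e := hg (.some x y h)
  rw [eι] at e ⊢
  rw [agreesWithRationalMapAt_iff, xy_some]
  refine ⟨Affine.Point.some_ne_zero hι, ?_, ?_, ?_⟩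
  · rw [← emb_eval_vec₂, map_ne_zero]
    exact hQ₁
  · rw [← emb_eval_vec₂, map_ne_zero]
    exact hQ₂
  · rw [hfP] at e
    obtain ⟨hι', eι'⟩ := localPointsEquivGeomPoints_pointsMapOfEmb_some K W' ι h'
    rw [eι'] at e
    exact Affine.Point.exists_eq_some_of_eq e
      (by rw [map_div₀, emb_eval_vec₂, emb_eval_vec₂])
      (by rw [map_div₀, emb_eval_vec₂, emb_eval_vec₂])

variable [Algebra.IsAlgebraic k K]

/-- The transport `e_E` is surjective for `K/k` algebraic (`pointsMapOfEmb_bijective`).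
[cite: SilvermanAEC2009, VIII.§1] -/
theorem localPointsEquivGeomPoints_pointsMapOfEmb_surjective :
    Function.Surjective fun P : geomPoints W ↦ localPointsEquivGeomPoints W K (pointsMapOfEmb W ι P) :=
  (localPointsEquivGeomPoints W K).surjective.comp (pointsMapOfEmb_bijective K W ι).2

/-- **Algebraicity is transported along `e`.** If `f : E(k̄) → E'(k̄)` is algebraic (agrees with a
rational map off a finite set) and `g ∘ e_E = e_{E'} ∘ f`, then `g : E_K(K̄) → E'_K(K̄)` is algebraic:
its exceptional set is the `e_E`-image of that of `f` (here `K/k` algebraic, so `e_E` is onto).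
Silverman, *AEC*, I.§3 (a rational map over `k` is a rational map over `K ⊇ k`; Remark 3.1).
[cite: SilvermanAEC2009, I.§3 Remark 3.1] -/
theorem isAlgebraicOn_transport {f : geomPoints W → geomPoints W'}
    {g : geomPoints (W.baseChange K) → geomPoints (W'.baseChange K)}
    (hg : ∀ P : geomPoints W, g (localPointsEquivGeomPoints W K (pointsMapOfEmb W ι P)) =
      localPointsEquivGeomPoints W' K (pointsMapOfEmb W' ι (f P)))
    (hf : IsAlgebraicOn W W' f) : IsAlgebraicOn (W.baseChange K) (W'.baseChange K) g := by
  obtain ⟨ρ⟩ := isAlgebraicOn_iff_nonempty_ratRep.mp hf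
  refine ⟨MvPolynomial.map ι.toRingHom ρ.P₁, MvPolynomial.map ι.toRingHom ρ.Q₁,
    MvPolynomial.map ι.toRingHom ρ.P₂, MvPolynomial.map ι.toRingHom ρ.Q₂, ?_⟩
  refine ((ρ.exc.finite_toSet).image fun P ↦
    localPointsEquivGeomPoints W K (pointsMapOfEmb W ι P)).subset fun Q hQ ↦ ?_
  by_contra hmem
  apply hQ
  obtain ⟨P, rfl⟩ := localPointsEquivGeomPoints_pointsMapOfEmb_surjective K W ι Q
  have hP : P ∉ ρ.exc := fun h ↦ hmem ⟨P, h, rfl⟩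
  exact agreesWithRationalMapAt_transport K W W' ι hg (ρ.agrees_of_not_mem_exc hP)

end Emb

/-! ## §2 Along the chosen embedding: equivariance, kernel, and the transported isogeny -/

section Chosen

variable [Algebra.IsAlgebraic k K]

/-- **Equivariance is transported.** If `f : E(k̄) → E'(k̄)` commutes with the restrictions
`γ|_{k̄}` of all `γ ∈ Γ_K` and `g ∘ e_E = e_{E'} ∘ f`, then `g` commutes with `Γ_K`
(`e` is `Γ_K`-equivariant along `absGaloisRestrict`). Serre, *Galois Cohomology*, II.§1.1;
Silverman, *AEC*, I.§3 Ex. 1.12(c). [cite: SilvermanAEC2009, I.§3 Ex. 1.12(c)] -/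
theorem smul_transport_baseChange {f : geomPoints W → geomPoints W'}
    {g : geomPoints (W.baseChange K) → geomPoints (W'.baseChange K)}
    (hg : ∀ P : geomPoints W, g (localPointsEquivGeomPoints W K
        (pointsMapOfEmb W (absClosureEmbedding k K) P)) =
      localPointsEquivGeomPoints W' K (pointsMapOfEmb W' (absClosureEmbedding k K) (f P)))
    (hG : ∀ (γ : absoluteGaloisGroup K) (P : geomPoints W),
      f (absGaloisRestrict k K γ • P) = absGaloisRestrict k K γ • f P)
    (γ : absoluteGaloisGroup K) (Q : geomPoints (W.baseChange K)) : g (γ • Q) = γ • g Q := by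
  obtain ⟨P, rfl⟩ :=
    localPointsEquivGeomPoints_pointsMapOfEmb_surjective K W (absClosureEmbedding k K) Q
  change g (γ • localPointsEquivGeomPoints W K (pointsMapOfEmb W (absClosureEmbedding k K) P)) =
    γ • g (localPointsEquivGeomPoints W K (pointsMapOfEmb W (absClosureEmbedding k K) P))
  rw [← localPointsEquivGeomPoints_pointsMapOfEmb_smul, hg, hg, hG,
    localPointsEquivGeomPoints_pointsMapOfEmb_smul]

/-- **The kernel is transported.** For additive `f`, `g` with `g ∘ e_E = e_{E'} ∘ f`, the kernel of
`g` is the `e_E`-image of the kernel of `f`; in particular it is finite when `ker f` is.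
Silverman, *AEC*, III.§4 (Cor. 4.9: the kernel of a non-zero isogeny is finite). [cite: SilvermanAEC2009, III.4.9] -/
theorem finite_ker_transport_baseChange {f : geomPoints W →+ geomPoints W'}
    {g : geomPoints (W.baseChange K) →+ geomPoints (W'.baseChange K)}
    (hg : ∀ P : geomPoints W, g (localPointsEquivGeomPoints W K
        (pointsMapOfEmb W (absClosureEmbedding k K) P)) =
      localPointsEquivGeomPoints W' K (pointsMapOfEmb W' (absClosureEmbedding k K) (f P)))
    (hker : (f.ker : Set (geomPoints W)).Finite) :
    (g.ker : Set (geomPoints (W.baseChange K))).Finite := by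
  refine (hker.image fun P ↦ localPointsEquivGeomPoints W K
    (pointsMapOfEmb W (absClosureEmbedding k K) P)).subset fun Q hQ ↦ ?_
  obtain ⟨P, rfl⟩ :=
    localPointsEquivGeomPoints_pointsMapOfEmb_surjective K W (absClosureEmbedding k K) Q
  refine ⟨P, ?_, rfl⟩
  have h0 : g (localPointsEquivGeomPoints W K (pointsMapOfEmb W (absClosureEmbedding k K) P)) = 0 :=
    hQ
  rw [hg, map_eq_zero_iff _ (localPointsEquivGeomPoints W' K).injective] at h0
  exact (AddMonoidHom.mem_ker).mpr
    (pointsMapOfEmb_injective W' (absClosureEmbedding k K) (by rw [h0, map_zero]))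

/-- **A `k̄`-algebraic homomorphism commuting with `Γ_K` is a `K`-isogeny of the base change.**
Let `K/k` be algebraic and `f : E(k̄) →+ E'(k̄)` an additive map which is algebraic (given by a rational
map with `k̄`-coefficients off a finite set), has finite kernel, and commutes with `γ|_{k̄}` for every
`γ ∈ Γ_K`. Then there is an isogeny `φ : E_K → E'_K` defined over `K` (a term of
`Isogeny (W.baseChange K) (W'.baseChange K)`) with `φ ∘ e_E = e_{E'} ∘ f` on `E(k̄)`. Silverman,
*AEC*, I.§3 ("defined over `K`" ⟺ `φ^σ = φ` for `σ ∈ G_{K̄/K}`, Ex. 1.12(c)), II.2.12, III.§4.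
[cite: SilvermanAEC2009, I.§3 Ex. 1.12(c) and III.§4] -/
theorem exists_isogeny_baseChange_of_isAlgebraicOn (f : geomPoints W →+ geomPoints W')
    (hf : IsAlgebraicOn W W' f)
    (hG : ∀ (γ : absoluteGaloisGroup K) (P : geomPoints W),
      f (absGaloisRestrict k K γ • P) = absGaloisRestrict k K γ • f P)
    (hker : (f.ker : Set (geomPoints W)).Finite) :
    ∃ φ : Isogeny (W.baseChange K) (W'.baseChange K), ∀ P : geomPoints W,
      φ (localPointsEquivGeomPoints W K (pointsMapOfEmb W (absClosureEmbedding k K) P)) =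
        localPointsEquivGeomPoints W' K (pointsMapOfEmb W' (absClosureEmbedding k K) (f P)) := by
  set ι := absClosureEmbedding k K with hι
  set e : geomPoints W ≃+ geomPoints (W.baseChange K) :=
    (AddEquiv.ofBijective (pointsMapOfEmb W ι) (pointsMapOfEmb_bijective K W ι)).trans
      (localPointsEquivGeomPoints W K) with he_def
  set e' : geomPoints W' ≃+ geomPoints (W'.baseChange K) :=
    (AddEquiv.ofBijective (pointsMapOfEmb W' ι) (pointsMapOfEmb_bijective K W' ι)).trans
      (localPointsEquivGeomPoints W' K) with he'_def
  have he : ∀ P, e P = localPointsEquivGeomPoints W K (pointsMapOfEmb W ι P) := fun P ↦ rfl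
  have he' : ∀ P, e' P = localPointsEquivGeomPoints W' K (pointsMapOfEmb W' ι P) := fun P ↦ rfl
  set g : geomPoints (W.baseChange K) →+ geomPoints (W'.baseChange K) :=
    (e' : geomPoints W' →+ geomPoints (W'.baseChange K)).comp
      (f.comp (e.symm : geomPoints (W.baseChange K) →+ geomPoints W)) with hg_def
  have hg : ∀ P : geomPoints W, g (localPointsEquivGeomPoints W K (pointsMapOfEmb W ι P)) =
      localPointsEquivGeomPoints W' K (pointsMapOfEmb W' ι (f P)) := fun P ↦ by
    rw [← he, ← he']
    simp [hg_def]
  exact ⟨⟨g, isAlgebraicOn_transport K W W' ι hg hf, smul_transport_baseChange K W W' hg hG,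
    finite_ker_transport_baseChange K W W' hg hker⟩, hg⟩

/-- **Base change of a `k`-isogeny to an algebraic extension `K/k`.** For `φ₀ : E → E'` an isogeny
defined over `k` there is an isogeny `φ : E_K → E'_K` defined over `K` with `φ ∘ e_E = e_{E'} ∘ φ₀`
on `E(k̄)`. Silverman, *AEC*, III.§4 (isogenies defined over `k`; base change of morphisms).
[cite: SilvermanAEC2009, III.§4] -/
theorem Isogeny.exists_baseChange_groundField (φ₀ : Isogeny W W') :
    ∃ φ : Isogeny (W.baseChange K) (W'.baseChange K), ∀ P : geomPoints W,
      φ (localPointsEquivGeomPoints W K (pointsMapOfEmb W (absClosureEmbedding k K) P)) =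
        localPointsEquivGeomPoints W' K (pointsMapOfEmb W' (absClosureEmbedding k K) (φ₀ P)) :=
  exists_isogeny_baseChange_of_isAlgebraicOn K W W' φ₀.toAddMonoidHom φ₀.isAlgebraic
    (fun γ P ↦ φ₀.equivariant (absGaloisRestrict k K γ) P) φ₀.finite_ker

/-- **Uniqueness of the transport**: two maps `E_K(K̄) → E'_K(K̄)` compatible with the same `f` along
`e` coincide (`e_E` is onto for `K/k` algebraic). [cite: SilvermanAEC2009, VIII.§1] -/
theorem transport_baseChange_unique {f : geomPoints W → geomPoints W'}
    {g₁ g₂ : geomPoints (W.baseChange K) → geomPoints (W'.baseChange K)}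
    (h₁ : ∀ P : geomPoints W, g₁ (localPointsEquivGeomPoints W K
        (pointsMapOfEmb W (absClosureEmbedding k K) P)) =
      localPointsEquivGeomPoints W' K (pointsMapOfEmb W' (absClosureEmbedding k K) (f P)))
    (h₂ : ∀ P : geomPoints W, g₂ (localPointsEquivGeomPoints W K
        (pointsMapOfEmb W (absClosureEmbedding k K) P)) =
      localPointsEquivGeomPoints W' K (pointsMapOfEmb W' (absClosureEmbedding k K) (f P))) :
    g₁ = g₂ := by
  funext Q
  obtain ⟨P, rfl⟩ :=
    localPointsEquivGeomPoints_pointsMapOfEmb_surjective K W (absClosureEmbedding k K) Q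
  change g₁ (localPointsEquivGeomPoints W K (pointsMapOfEmb W (absClosureEmbedding k K) P)) =
    g₂ (localPointsEquivGeomPoints W K (pointsMapOfEmb W (absClosureEmbedding k K) P))
  rw [h₁, h₂]

/-- Two isogenies `E_K → E'_K` transporting the same `f` are equal (an isogeny is determined by its
values on `K̄`-points). [cite: SilvermanAEC2009, III.§4] -/
theorem isogeny_baseChange_unique {f : geomPoints W → geomPoints W'}
    {φ₁ φ₂ : Isogeny (W.baseChange K) (W'.baseChange K)}
    (h₁ : ∀ P : geomPoints W, φ₁ (localPointsEquivGeomPoints W K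
        (pointsMapOfEmb W (absClosureEmbedding k K) P)) =
      localPointsEquivGeomPoints W' K (pointsMapOfEmb W' (absClosureEmbedding k K) (f P)))
    (h₂ : ∀ P : geomPoints W, φ₂ (localPointsEquivGeomPoints W K
        (pointsMapOfEmb W (absClosureEmbedding k K) P)) =
      localPointsEquivGeomPoints W' K (pointsMapOfEmb W' (absClosureEmbedding k K) (f P))) :
    φ₁ = φ₂ :=
  Isogeny.ext fun Q ↦ congrFun (transport_baseChange_unique K W W' h₁ h₂) Q

/-- **Transport of a quadratic relation.** If `f : E(k̄) →+ E(k̄)` satisfies `f(fP) + m·fP = c·P`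
and `g ∘ e_E = e_E ∘ f` with `g` additive, then `g(gQ) + m·gQ = c·Q` on `E_K(K̄)` (used for CM
generators `η² + mη = c`: `End(E)` is a ring under composition, Silverman, *AEC*, III.§4).
[cite: SilvermanAEC2009, III.§4 (End(E))] -/
theorem rel_transport_baseChange {f : geomPoints W →+ geomPoints W}
    {g : geomPoints (W.baseChange K) →+ geomPoints (W.baseChange K)}
    (hg : ∀ P : geomPoints W, g (localPointsEquivGeomPoints W K
        (pointsMapOfEmb W (absClosureEmbedding k K) P)) =
      localPointsEquivGeomPoints W K (pointsMapOfEmb W (absClosureEmbedding k K) (f P)))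
    {m c : ℤ} (hrel : ∀ P : geomPoints W, f (f P) + m • f P = c • P)
    (Q : geomPoints (W.baseChange K)) : g (g Q) + m • g Q = c • Q := by
  obtain ⟨P, rfl⟩ :=
    localPointsEquivGeomPoints_pointsMapOfEmb_surjective K W (absClosureEmbedding k K) Q
  change g (g (localPointsEquivGeomPoints W K (pointsMapOfEmb W (absClosureEmbedding k K) P))) +
      m • g (localPointsEquivGeomPoints W K (pointsMapOfEmb W (absClosureEmbedding k K) P)) =
    c • localPointsEquivGeomPoints W K (pointsMapOfEmb W (absClosureEmbedding k K) P)
  rw [hg, hg, ← map_zsmul, ← map_zsmul, ← map_add, ← map_add, hrel, map_zsmul, map_zsmul]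

/-- **Transport of a composition identity.** If `ψ₀ (φ₀ P) = n·P` on `E(k̄)` and `φ`, `ψ` transport
`φ₀`, `ψ₀` along `e`, then `ψ (φ Q) = n·Q` on `E_K(K̄)` (used for an isogeny and its dual,
`ψ̂φ = [deg φ]`). Silverman, *AEC*, III.6.1. [cite: SilvermanAEC2009, III.6.1(a)] -/
theorem comp_eq_smul_transport_baseChange {φ₀ : geomPoints W → geomPoints W'}
    {ψ₀ : geomPoints W' → geomPoints W}
    {φ : geomPoints (W.baseChange K) → geomPoints (W'.baseChange K)}
    {ψ : geomPoints (W'.baseChange K) → geomPoints (W.baseChange K)}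
    (hφ : ∀ P : geomPoints W, φ (localPointsEquivGeomPoints W K
        (pointsMapOfEmb W (absClosureEmbedding k K) P)) =
      localPointsEquivGeomPoints W' K (pointsMapOfEmb W' (absClosureEmbedding k K) (φ₀ P)))
    (hψ : ∀ P' : geomPoints W', ψ (localPointsEquivGeomPoints W' K
        (pointsMapOfEmb W' (absClosureEmbedding k K) P')) =
      localPointsEquivGeomPoints W K (pointsMapOfEmb W (absClosureEmbedding k K) (ψ₀ P')))
    {n : ℤ} (h : ∀ P : geomPoints W, ψ₀ (φ₀ P) = n • P)
    (Q : geomPoints (W.baseChange K)) : ψ (φ Q) = n • Q := by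
  obtain ⟨P, rfl⟩ :=
    localPointsEquivGeomPoints_pointsMapOfEmb_surjective K W (absClosureEmbedding k K) Q
  change ψ (φ (localPointsEquivGeomPoints W K (pointsMapOfEmb W (absClosureEmbedding k K) P))) =
    n • localPointsEquivGeomPoints W K (pointsMapOfEmb W (absClosureEmbedding k K) P)
  rw [hφ, hψ, h, map_zsmul, map_zsmul]

end Chosen

end WeierstrassCurve
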